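/-
Copyright (c) 2026 the pub-hodgecm-mathlib formalisation cell (harness21).  Prover seat hodgecm-mathlib-K2Liu-p07 (g2): Track B «K2-LIT»,
#184♮ = hLiu418 = stmt-HodgeConjecture-24832; LEAD F0P6-plan (g10) DEAL∕SWAP 2026-09-03T23:05:23Z «O41.4» (organ of socket #41
`sig_K2LiuSiegelEisensteinContinuation`); REPORT-FIRST O41.4 99eb0f16d8bad5ea, file (b); 2026-09-03.
-/
import Summits.HodgeConjecture.HodgeConjecture.Theorems.K2LiuSiegelBigCellFree
import Summits.HodgeConjecture.HodgeConjecture.Theorems.K2LiuSiegelEisensteinDoubledLeftInvariant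
import Summits.HodgeConjecture.HodgeConjecture.Theorems.K2LiuUnipotentCoveringWeight
import Mathlib.MeasureTheory.Group.Measure
import HarnessLib

/-!
# Crux `HLiu418`, road `K2_Liu`, organ O41.4 file (b): the `w_Δ`-cell of the constant term along `N_Δ` unfolds to the FULL
# intertwining integral — `Σ'_{ν ∈ N_Δ(L⁺)} ‖f(γ_{[w_Δ ν]} u h)‖` integrated over a weighted fundamental domain of `N_Δ(L⁺)\N_Δ(𝔸)`
# equals `∫_{N_Δ(𝔸)} ‖f(w_Δ u h)‖ du`, and the THREE-CELL SPLIT of the absolute constant term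

Cell `hodgecm-mathlib`, crux item hLiu418 = `stmt-HodgeConjecture-24832`, route `HCCMUnconditional`; squad K2 ∕ K2Liu, LEAD F0P6-plan (g10),
planner K2Liu-plan (g0), #41 steward lineage K2Liu-p01, prover K2Liu-p07 (g2).  THEOREMS ONLY (no `def`, no instance, no notation, no named-fact
hypothesis, no `sorry`); lane `--supports stmt-HodgeConjecture-24832` (count-neutral helper).

SETTING (★ D9 `K2Lit/SiegelDoubledUnipotent` + ★ covering weights `Literature/MeasureTheory/Group/CoveringWeights`).  `N = N_Δ(𝔸) = ↥unipDelta`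
with its subgroup topology, caller-supplied Borel structure `[MeasurableSpace N] [BorelSpace N]` and a Haar measure `νN` (binders, ref1 23:05:26Z);
`Γ_N = N_Δ(L⁺) = unipDeltaRat ≤ N` (countable: ★ `K2LiuUnipotentCoveringWeight.countable_unipDeltaRat`, whose
`exists_isCoveringWeight_unipDeltaRat_lintegral_ne_top` also PRODUCES the weights `β` below); `β : N → [0,∞]` an `N_Δ(L⁺)`-COVERING WEIGHT (`Σ_{ν ∈ Γ_N} β(ν u) = 1`; a
smooth fundamental domain of `N_Δ(L⁺)\N_Δ(𝔸)`, ★ `IsCoveringWeight`); `f` a Siegel section (★ `IsSiegelDeltaSection χ s f`: left `P_Δ(L⁺)`-invariant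
by ★ #10b `apply_siegelDeltaRat_mul`), continuous; `γ_q = Quotient.out q ∈ H(L⁺)` the representatives of `q ∈ P_Δ(L⁺)\H(L⁺)` (★ `SiegelDeltaQuot`) used
by ★ `eisensteinSeriesDelta f h = Σ'_q f(γ_q h)`; `w_Δ` the big-cell Weyl element (★ `weylDelta`), presented on the rational side by a binder
`wq : Γ_N → H(L⁺)`, `wq ν = w_Δ ν` (it exists iff `w_Δ ∈ H(L⁺)`, which holds — `w_Δ = ι(1,−1)` — and is O41.1's bookkeeping; no rationality of `w_Δ`
is USED beyond this presentation).

WHAT IS PROVED.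
* §1 the `w_Δ`-ORBIT of the right `N_Δ(L⁺)`-action on `P_Δ(L⁺)\H(L⁺)`: `ν ↦ [w_Δ ν]` is INJECTIVE (★ file (a) `eq_of_isSiegelDelta_weylDelta_mul`:
  the big cell is free) and misses the identity coset (★ (a) `not_isSiegelDelta_mul_weylDelta_mul`, `0 < n`); along it the summand is
  `f(γ_{[w_Δ ν]} x) = f(w_Δ ν x)` and at the identity `f(γ_{[1]} x) = f(x)` (representative independence, ★ #10b).
* §2 **`lintegral_weylDelta_orbit_unfold`**: `∫⁻ (Σ'_ν ‖f(w_Δ ν u h)‖ₑ) β(u) dνN = ∫⁻ ‖f(w_Δ u h)‖ₑ dνN` — unfolding `N(L⁺)\N(𝔸)` against the free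
  orbit (★ `lintegral_mul_eq_lintegral_tsum_mul` with `Γ' = 1`, Tonelli; NO convergence hypothesis, an identity in `[0, ∞]`).
* §3 **`lintegral_constTerm_abs_three_cells`** — THE THREE-CELL SPLIT of the absolute constant term:
  `∫⁻ (Σ'_q ‖f(γ_q u h)‖ₑ) β(u) dνN = ‖f(h)‖ₑ · ∫⁻ β dνN + ∫⁻ ‖f(w_Δ u h)‖ₑ dνN + ∫⁻ (Σ'_{q ∈ REST} ‖f(γ_q u h)‖ₑ) β(u) dνN`,
  `REST = P_Δ(L⁺)\H(L⁺) ∖ ({[1]} ∪ [w_Δ N_Δ(L⁺)])` (for `n = 2`: the cosets of the single rank-1 double coset).  Unconditional (Tonelli).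
* §4 COROLLARIES under the analytic binder (H) `∫⁻ (Σ'_q ‖f(γ_q u h)‖ₑ) β dνN ≠ ∞` of REPORT-FIRST O41.4: each cell is finite; in particular
  **`integrable_weylDelta_mul_of_lintegral_ne_top`**: `u ↦ f(w_Δ u h)` is `νN`-integrable — the convergence of the Siegel intertwining integral
  `M(s)f(h) = intertwiningDelta νN f h` AT `h` (organ O41.3's conclusion at `h`, for K2Liu-p06 to cite), and the REST cell is finite.
File (c) `K2LiuConstantTermDelta` turns §3 into the Bochner identity `CT_β(E f)(h) = vol_β·f(h) + M(s)f(h) + MID(f)(h)` under (H).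
[MoeglinWaldspurger1995, II.1.7], [GelbartPiatetskishapiroRallis1987, Part A §§1–2], [KudlaRallis1994, §2], [Tan1999, §2], [Garrett2018, §3.10].
HONEST LABEL.  Count-neutral helper; `HC_CM` is proved only modulo the 7 printed citations (2 remaining named inputs: hLiu418 =
`stmt-HodgeConjecture-24832`, h413 = `stmt-HodgeConjecture-24833`) until rung 0 closes.
-/

set_option autoImplicit false
set_option linter.dupNamespace false -- the mandated namespace repeats `HodgeConjecture.HodgeConjecture`

noncomputable section

open scoped Matrix ENNReal NNReal
open NumberField IsDedekindDomain MeasureTheory MeasureTheory.Measure Filter Set Function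
open Literature.NumberTheory.Automorphic Literature.NumberTheory.GaloisRepresentations
open Literature.NumberTheory.GelbartRogawski1991 Literature.NumberTheory.GelbartRogawski1991.GRConstruction
open Literature.NumberTheory.K2Lit.SiegelDoubled Literature.MeasureTheory.Group

namespace Summit.HodgeConjecture.HodgeConjecture.Cruxes.HLiu418.K2LiuConstantTermBigCellUnfold

open K2LiuSiegelBigCellFree K2LiuSiegelEisensteinDoubledLeftInvariant K2LiuSiegelDoubledUnfold K2LiuUnipotentCoveringWeight

variable (L : Type) [Field L] [NumberField L] [IsCMField L]
variable {N M n : ℕ} (e : Fin N × Fin M ≃ Fin n)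
  (dV : Fin N → L) (hdV : ∀ i, IsCMField.complexConj L (dV i) = dV i)
  (dW : Fin M → L) (hdW : ∀ i, IsCMField.complexConj L (dW i) = dW i)

/-! ## §0 Representative independence of the summand (`N_Δ(L⁺)` is countable: ★ `K2LiuUnipotentCoveringWeight.countable_unipDeltaRat`) -/

variable {L e dV hdV dW hdW} in
/-- **Representative independence**: for a Siegel section `f` and `a ∈ H(L⁺)`, `f(γ_{[a]} x) = f(a x)` — the chosen representative `γ_{[a]} = Quotient.out [a]`
differs from `a` by a left factor in `P_Δ(L⁺)`, on which `f` is invariant (★ #10b `apply_siegelDeltaRat_mul`). [cite: Tan1999, §1] [cite: Garrett2018, §3.10] -/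
theorem apply_out_mk_mul {χ : HeckeCharacter L} {s : ℂ} {f : HA L e dV hdV dW hdW → ℂ} (hf : IsSiegelDeltaSection L e dV hdV dW hdW χ s f)
    (a : ratH L e dV hdV dW hdW) (x : HA L e dV hdV dW hdW) :
    f ((((Quotient.out (Quotient.mk (MulAction.orbitRel (siegelDeltaRat L e dV hdV dW hdW) (ratH L e dV hdV dW hdW)) a) :
        ratH L e dV hdV dW hdW) : HA L e dV hdV dW hdW)) * x) = f (((a : ratH L e dV hdV dW hdW) : HA L e dV hdV dW hdW) * x) := by
  have hrel : MulAction.orbitRel (siegelDeltaRat L e dV hdV dW hdW) (ratH L e dV hdV dW hdW)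
      (Quotient.out (Quotient.mk (MulAction.orbitRel (siegelDeltaRat L e dV hdV dW hdW) (ratH L e dV hdV dW hdW)) a)) a :=
    Quotient.exact (Quotient.out_eq _)
  obtain ⟨p, hp⟩ := MulAction.mem_orbit_iff.1 (MulAction.orbitRel_apply.1 hrel)
  have hval : (((Quotient.out (Quotient.mk (MulAction.orbitRel (siegelDeltaRat L e dV hdV dW hdW) (ratH L e dV hdV dW hdW)) a) :
      ratH L e dV hdV dW hdW) : HA L e dV hdV dW hdW)) = ((p : ratH L e dV hdV dW hdW) : HA L e dV hdV dW hdW) * (a : HA L e dV hdV dW hdW) := by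
    rw [← hp]; rfl
  rw [hval, mul_assoc, apply_siegelDeltaRat_mul L e dV hdV dW hdW hf p]

/-! ## §1 The `w_Δ`-orbit `ν ↦ [w_Δ ν]` of the right `N_Δ(L⁺)`-action on `P_Δ(L⁺)\H(L⁺)` -/

section Orbit

variable {L e dV hdV dW hdW}
variable (wq : unipDeltaRat L e dV hdV dW hdW → ratH L e dV hdV dW hdW)
  (hwq : ∀ ν, ((wq ν : ratH L e dV hdV dW hdW) : HA L e dV hdV dW hdW) =
    weylDelta L e dV hdV dW hdW * ((ν : unipDelta L e dV hdV dW hdW) : HA L e dV hdV dW hdW))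

include hwq in
/-- **`ν ↦ [w_Δ ν]` is injective on `N_Δ(L⁺)`**: `[w_Δ ν] = [w_Δ ν']` means `p · w_Δ ν' = w_Δ ν` with `p ∈ P_Δ(L⁺)`, and the big cell is free
(★ (a) `eq_of_isSiegelDelta_weylDelta_mul`). [cite: MoeglinWaldspurger1995, II.1.7] [cite: GelbartPiatetskishapiroRallis1987, Part A §1] -/
theorem mk_wq_injective :
    Function.Injective (fun ν : unipDeltaRat L e dV hdV dW hdW =>
      (Quotient.mk (MulAction.orbitRel (siegelDeltaRat L e dV hdV dW hdW) (ratH L e dV hdV dW hdW)) (wq ν) : SiegelDeltaQuot L e dV hdV dW hdW)) := by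
  intro ν ν' h
  have hrel : MulAction.orbitRel (siegelDeltaRat L e dV hdV dW hdW) (ratH L e dV hdV dW hdW) (wq ν) (wq ν') := Quotient.exact h
  obtain ⟨p, hp⟩ := MulAction.mem_orbit_iff.1 (MulAction.orbitRel_apply.1 hrel)
  have hpS : IsSiegelDelta L e dV hdV dW hdW ((p : ratH L e dV hdV dW hdW) : HA L e dV hdV dW hdW) :=
    (mem_siegelDelta_iff L e dV hdV dW hdW _).1 (Subgroup.mem_subgroupOf.1 p.2)
  have hval : ((p : ratH L e dV hdV dW hdW) : HA L e dV hdV dW hdW) * (weylDelta L e dV hdV dW hdW * ((ν' : unipDelta L e dV hdV dW hdW) : HA L e dV hdV dW hdW)) =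
      weylDelta L e dV hdV dW hdW * ((ν : unipDelta L e dV hdV dW hdW) : HA L e dV hdV dW hdW) := by
    rw [← hwq ν, ← hwq ν', ← hp]; rfl
  have hνν' : ((ν' : unipDelta L e dV hdV dW hdW) : HA L e dV hdV dW hdW) = ((ν : unipDelta L e dV hdV dW hdW) : HA L e dV hdV dW hdW) :=
    eq_of_isSiegelDelta_weylDelta_mul L e dV hdV dW hdW hpS (ν' : unipDelta L e dV hdV dW hdW).2 (ν : unipDelta L e dV hdV dW hdW).2 hval
  exact Subtype.ext (Subtype.ext hνν'.symm)

include hwq in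
/-- **The `w_Δ`-orbit misses the identity coset** (`0 < n`): `[w_Δ ν] = [1]` would put `w_Δ ν` in `P_Δ(L⁺)` (★ (a) `not_isSiegelDelta_weylDelta_mul`).
[cite: MoeglinWaldspurger1995, II.1.7] [cite: GelbartPiatetskishapiroRallis1987, Part A §1] -/
theorem mk_wq_ne_mk_one (hn : 0 < n) (ν : unipDeltaRat L e dV hdV dW hdW) :
    (Quotient.mk (MulAction.orbitRel (siegelDeltaRat L e dV hdV dW hdW) (ratH L e dV hdV dW hdW)) (wq ν) : SiegelDeltaQuot L e dV hdV dW hdW) ≠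
      Quotient.mk (MulAction.orbitRel (siegelDeltaRat L e dV hdV dW hdW) (ratH L e dV hdV dW hdW)) 1 := by
  intro h
  have hrel : MulAction.orbitRel (siegelDeltaRat L e dV hdV dW hdW) (ratH L e dV hdV dW hdW) (wq ν) 1 := Quotient.exact h
  obtain ⟨p, hp⟩ := MulAction.mem_orbit_iff.1 (MulAction.orbitRel_apply.1 hrel)
  have hpS : IsSiegelDelta L e dV hdV dW hdW ((p : ratH L e dV hdV dW hdW) : HA L e dV hdV dW hdW) :=
    (mem_siegelDelta_iff L e dV hdV dW hdW _).1 (Subgroup.mem_subgroupOf.1 p.2)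
  have hval : weylDelta L e dV hdV dW hdW * ((ν : unipDelta L e dV hdV dW hdW) : HA L e dV hdV dW hdW) =
      ((p : ratH L e dV hdV dW hdW) : HA L e dV hdV dW hdW) := by
    rw [← hwq ν, ← hp, Subgroup.smul_def, smul_eq_mul, mul_one]
  exact not_isSiegelDelta_weylDelta_mul L e dV hdV dW hdW hn (ν : unipDelta L e dV hdV dW hdW).2 (by rw [hval]; exact hpS)

include hwq in
/-- Along the orbit the summand is `f(γ_{[w_Δ ν]} x) = f(w_Δ ν x)`. [cite: Tan1999, §1] [cite: Garrett2018, §3.10] -/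
theorem apply_out_mk_wq_mul {χ : HeckeCharacter L} {s : ℂ} {f : HA L e dV hdV dW hdW → ℂ} (hf : IsSiegelDeltaSection L e dV hdV dW hdW χ s f)
    (ν : unipDeltaRat L e dV hdV dW hdW) (x : HA L e dV hdV dW hdW) :
    f ((((Quotient.out (Quotient.mk (MulAction.orbitRel (siegelDeltaRat L e dV hdV dW hdW) (ratH L e dV hdV dW hdW)) (wq ν) :
        SiegelDeltaQuot L e dV hdV dW hdW) : ratH L e dV hdV dW hdW) : HA L e dV hdV dW hdW)) * x) =
      f (weylDelta L e dV hdV dW hdW * ((ν : unipDelta L e dV hdV dW hdW) : HA L e dV hdV dW hdW) * x) := by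
  rw [← hwq ν]
  exact apply_out_mk_mul hf (wq ν) x

/-- At the identity coset the summand is `f(γ_{[1]} x) = f(x)`. [cite: Tan1999, §1] -/
theorem apply_out_mk_one_mul {χ : HeckeCharacter L} {s : ℂ} {f : HA L e dV hdV dW hdW → ℂ} (hf : IsSiegelDeltaSection L e dV hdV dW hdW χ s f)
    (x : HA L e dV hdV dW hdW) :
    f ((((Quotient.out (Quotient.mk (MulAction.orbitRel (siegelDeltaRat L e dV hdV dW hdW) (ratH L e dV hdV dW hdW)) 1 :
        SiegelDeltaQuot L e dV hdV dW hdW) : ratH L e dV hdV dW hdW) : HA L e dV hdV dW hdW)) * x) = f x := by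
  rw [apply_out_mk_mul hf 1 x, OneMemClass.coe_one, one_mul]

end Orbit

/-! ## §2 Unfolding the free orbit: `∫⁻ (Σ'_ν ‖f(w_Δ ν u h)‖ₑ) β dνN = ∫⁻ ‖f(w_Δ u h)‖ₑ dνN` -/

section Unfold

variable {L e dV hdV dW hdW}
variable [MeasurableSpace (unipDelta L e dV hdV dW hdW)] [BorelSpace (unipDelta L e dV hdV dW hdW)]

/-- the translate `u ↦ f(a · u · h)` of a continuous `f` is continuous on `N_Δ(𝔸)`, hence (Borel) measurable, and so is its `‖·‖ₑ`. [folklore] -/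
theorem measurable_enorm_apply_mul_coe_mul {f : HA L e dV hdV dW hdW → ℂ} (hfc : Continuous f) (a h : HA L e dV hdV dW hdW) :
    Measurable (fun u : unipDelta L e dV hdV dW hdW => ‖f (a * (u : HA L e dV hdV dW hdW) * h)‖ₑ) :=
  (hfc.comp ((continuous_const.mul continuous_subtype_val).mul continuous_const)).measurable.enorm

/-- the same for the association `f(a · (u · h))` used by ★ `eisensteinSeriesDelta f (u h)`. [folklore] -/
theorem measurable_enorm_apply_mul_coe_mul' {f : HA L e dV hdV dW hdW → ℂ} (hfc : Continuous f) (a h : HA L e dV hdV dW hdW) :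
    Measurable (fun u : unipDelta L e dV hdV dW hdW => ‖f (a * ((u : HA L e dV hdV dW hdW) * h))‖ₑ) :=
  (hfc.comp (continuous_const.mul (continuous_subtype_val.mul continuous_const))).measurable.enorm

/-- **UNFOLDING THE FREE `w_Δ`-ORBIT** (no convergence hypothesis; Tonelli in `[0, ∞]`): for a Haar measure `νN` on `N_Δ(𝔸)`, an `N_Δ(L⁺)`-covering weight
`β` and a continuous `f`,  `∫⁻ (Σ'_{ν ∈ N_Δ(L⁺)} ‖f(w_Δ ν u h)‖ₑ) β(u) dνN(u) = ∫⁻ ‖f(w_Δ u h)‖ₑ dνN(u)` — ★ `lintegral_mul_eq_lintegral_tsum_mul` with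
`Γ = N_Δ(L⁺)`, `Γ' = 1` (covering weight `1`), representatives `ν ↦ ν`. [cite: Garrett2018, §3.10] [cite: MoeglinWaldspurger1995, II.1.7] -/
theorem lintegral_weylDelta_orbit_unfold (νN : Measure (unipDelta L e dV hdV dW hdW)) [νN.IsMulLeftInvariant]
    {β : unipDelta L e dV hdV dW hdW → ℝ≥0∞} (hβ : IsCoveringWeight (unipDeltaRat L e dV hdV dW hdW) β)
    {f : HA L e dV hdV dW hdW → ℂ} (hfc : Continuous f) (h : HA L e dV hdV dW hdW) :
    ∫⁻ u, (∑' ν : unipDeltaRat L e dV hdV dW hdW,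
        ‖f (weylDelta L e dV hdV dW hdW * ((ν : unipDelta L e dV hdV dW hdW) : HA L e dV hdV dW hdW) * ((u : HA L e dV hdV dW hdW) * h))‖ₑ) * β u ∂νN =
      ∫⁻ u, ‖f (weylDelta L e dV hdV dW hdW * (u : HA L e dV hdV dW hdW) * h)‖ₑ ∂νN := by
  haveI : Countable (unipDeltaRat L e dV hdV dW hdW) := countable_unipDeltaRat L e dV hdV dW hdW
  haveI : MeasurableConstSMul (unipDelta L e dV hdV dW hdW) (unipDelta L e dV hdV dW hdW) := ⟨fun g => measurable_const_mul g⟩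
  haveI : SMulInvariantMeasure (unipDelta L e dV hdV dW hdW) (unipDelta L e dV hdV dW hdW) νN :=
    ⟨fun g s _hs => by rw [show (fun x : unipDelta L e dV hdV dW hdW => g • x) ⁻¹' s = (fun x => g * x) ⁻¹' s from rfl, measure_preimage_mul]⟩
  -- the data of ★ `lintegral_mul_eq_lintegral_tsum_mul` with `Γ' = ⊥`, `β' = 1`, `s = Subtype.val`
  set F : unipDelta L e dV hdV dW hdW → ℝ≥0∞ := fun u => ‖f (weylDelta L e dV hdV dW hdW * (u : HA L e dV hdV dW hdW) * h)‖ₑ with hF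
  have hFm : Measurable F := measurable_enorm_apply_mul_coe_mul hfc _ _
  have h1w : ∀ x : unipDelta L e dV hdV dW hdW, coveringSum (⊥ : Subgroup (unipDelta L e dV hdV dW hdW)) (fun _ => (1 : ℝ≥0∞)) x = 1 := by
    intro x
    rw [coveringSum_apply, tsum_eq_single (1 : (⊥ : Subgroup (unipDelta L e dV hdV dW hdW))) (fun b hb => absurd (Subsingleton.elim b 1) hb)]
  have hs : ∀ γ ∈ unipDeltaRat L e dV hdV dW hdW, ∃! i : unipDeltaRat L e dV hdV dW hdW,
      γ * ((i : unipDelta L e dV hdV dW hdW))⁻¹ ∈ (⊥ : Subgroup (unipDelta L e dV hdV dW hdW)) := by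
    intro γ hγ
    refine ⟨⟨γ, hγ⟩, by simp, fun i hi => ?_⟩
    have hi' : γ * ((i : unipDelta L e dV hdV dW hdW))⁻¹ ∈ (⊥ : Subgroup (unipDelta L e dV hdV dW hdW)) := hi
    rw [Subgroup.mem_bot, mul_inv_eq_one] at hi'
    exact Subtype.ext hi'.symm
  have key := lintegral_mul_eq_lintegral_tsum_mul νN (unipDeltaRat L e dV hdV dW hdW) ⊥ bot_le (F := F) (β' := fun _ => 1) (β := β)
    hFm (fun γ hγ x => by rw [Subgroup.mem_bot] at hγ; rw [hγ, one_smul]) measurable_const h1w hβ.1 hβ.2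
    (s := fun i : unipDeltaRat L e dV hdV dW hdW => (i : unipDelta L e dV hdV dW hdW)) (fun i => i.2) hs
  simp only [mul_one] at key
  rw [key]
  refine lintegral_congr fun u => ?_
  congr 1
  refine tsum_congr fun ν => ?_
  rw [hF]
  simp only [smul_eq_mul, Subgroup.coe_mul, mul_assoc]

end Unfold

/-! ## §3 The three-cell split of the absolute constant term (Tonelli) -/

section Split

variable {L e dV hdV dW hdW}
variable [MeasurableSpace (unipDelta L e dV hdV dW hdW)] [BorelSpace (unipDelta L e dV hdV dW hdW)]
variable (wq : unipDeltaRat L e dV hdV dW hdW → ratH L e dV hdV dW hdW)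
  (hwq : ∀ ν, ((wq ν : ratH L e dV hdV dW hdW) : HA L e dV hdV dW hdW) =
    weylDelta L e dV hdV dW hdW * ((ν : unipDelta L e dV hdV dW hdW) : HA L e dV hdV dW hdW))

include hwq in
/-- **THE THREE-CELL SPLIT OF THE ABSOLUTE CONSTANT TERM ALONG `N_Δ`** (Tonelli; no convergence hypothesis).  With `γ_q = Quotient.out q`,
`S = {[1]} ∪ {[w_Δ ν] : ν ∈ N_Δ(L⁺)}` and `REST = Sᶜ ⊆ P_Δ(L⁺)\H(L⁺)`:
  `∫⁻ (Σ'_q ‖f(γ_q u h)‖ₑ) β(u) dνN = ‖f(h)‖ₑ · ∫⁻ β dνN + ∫⁻ ‖f(w_Δ u h)‖ₑ dνN + ∫⁻ (Σ'_{q ∈ REST} ‖f(γ_q u h)‖ₑ) β(u) dνN`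
— identity cell (★ D9 `apply_unipDelta_mul`: `f(u h) = f(h)`), free `w_Δ`-cell (§2), and the remaining cosets (for `n = 2`: the rank-1 double
coset, whose contribution is the `GL₂(𝔸_L)`-Borel Eisenstein term `E₁` — identified in a later organ, here carried verbatim).
[cite: MoeglinWaldspurger1995, II.1.7] [cite: KudlaRallis1994, §2] [cite: Tan1999, §2] [cite: Garrett2018, §3.10] -/
theorem lintegral_constTerm_abs_three_cells (hn : 0 < n) (νN : Measure (unipDelta L e dV hdV dW hdW)) [νN.IsMulLeftInvariant]
    {β : unipDelta L e dV hdV dW hdW → ℝ≥0∞} (hβ : IsCoveringWeight (unipDeltaRat L e dV hdV dW hdW) β)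
    {χ : HeckeCharacter L} {s : ℂ} {f : HA L e dV hdV dW hdW → ℂ} (hf : IsSiegelDeltaSection L e dV hdV dW hdW χ s f) (hfc : Continuous f)
    (h : HA L e dV hdV dW hdW) :
    ∫⁻ u, (∑' q : SiegelDeltaQuot L e dV hdV dW hdW,
        ‖f ((((Quotient.out q : ratH L e dV hdV dW hdW) : HA L e dV hdV dW hdW)) * ((u : HA L e dV hdV dW hdW) * h))‖ₑ) * β u ∂νN =
      ‖f h‖ₑ * ∫⁻ u, β u ∂νN +
        ∫⁻ u, ‖f (weylDelta L e dV hdV dW hdW * (u : HA L e dV hdV dW hdW) * h)‖ₑ ∂νN +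
        ∫⁻ u, (∑' q : ↥(({Quotient.mk (MulAction.orbitRel (siegelDeltaRat L e dV hdV dW hdW) (ratH L e dV hdV dW hdW)) 1} ∪
            Set.range (fun ν : unipDeltaRat L e dV hdV dW hdW =>
              (Quotient.mk (MulAction.orbitRel (siegelDeltaRat L e dV hdV dW hdW) (ratH L e dV hdV dW hdW)) (wq ν) :
                SiegelDeltaQuot L e dV hdV dW hdW)))ᶜ : Set (SiegelDeltaQuot L e dV hdV dW hdW)),
          ‖f ((((Quotient.out (q : SiegelDeltaQuot L e dV hdV dW hdW) : ratH L e dV hdV dW hdW) : HA L e dV hdV dW hdW)) *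
            ((u : HA L e dV hdV dW hdW) * h))‖ₑ) * β u ∂νN := by
  haveI : Countable (unipDeltaRat L e dV hdV dW hdW) := countable_unipDeltaRat L e dV hdV dW hdW
  haveI : Countable (ratH L e dV hdV dW hdW) := countable_ratH L e dV hdV dW hdW
  haveI : Countable (SiegelDeltaQuot L e dV hdV dW hdW) := by unfold SiegelDeltaQuot; exact inferInstance
  -- notation: the identity coset, the orbit map, the summands and their weighted integrals
  set q₁ : SiegelDeltaQuot L e dV hdV dW hdW :=
    Quotient.mk (MulAction.orbitRel (siegelDeltaRat L e dV hdV dW hdW) (ratH L e dV hdV dW hdW)) 1 with hq₁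
  set qw : unipDeltaRat L e dV hdV dW hdW → SiegelDeltaQuot L e dV hdV dW hdW := fun ν =>
    (Quotient.mk (MulAction.orbitRel (siegelDeltaRat L e dV hdV dW hdW) (ratH L e dV hdV dW hdW)) (wq ν) :
      SiegelDeltaQuot L e dV hdV dW hdW) with hqw
  set Fq : SiegelDeltaQuot L e dV hdV dW hdW → unipDelta L e dV hdV dW hdW → ℝ≥0∞ := fun q u =>
    ‖f ((((Quotient.out q : ratH L e dV hdV dW hdW) : HA L e dV hdV dW hdW)) * ((u : HA L e dV hdV dW hdW) * h))‖ₑ with hFq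
  have hFqm : ∀ q, Measurable (Fq q) := fun q => measurable_enorm_apply_mul_coe_mul' hfc _ h
  set I : SiegelDeltaQuot L e dV hdV dW hdW → ℝ≥0∞ := fun q => ∫⁻ u, Fq q u * β u ∂νN with hI
  -- Step A (Tonelli): `∫⁻ (Σ'_q Fq q) β = Σ'_q I q`
  have hA : ∫⁻ u, (∑' q, Fq q u) * β u ∂νN = ∑' q, I q := by
    have h1 : ∀ u, (∑' q, Fq q u) * β u = ∑' q, Fq q u * β u := fun u => ENNReal.tsum_mul_right.symm
    simp_rw [h1]
    exact lintegral_tsum fun q => ((hFqm q).mul hβ.1).aemeasurable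
  -- Step B: split `Σ'_q I q` along `{q₁} ∪ range qw` and its complement
  set S : Set (SiegelDeltaQuot L e dV hdV dW hdW) := {q₁} ∪ Set.range qw with hS
  have hdisj : Disjoint ({q₁} : Set (SiegelDeltaQuot L e dV hdV dW hdW)) (Set.range qw) := by
    rw [Set.disjoint_singleton_left]
    rintro ⟨ν, hν⟩
    exact mk_wq_ne_mk_one wq hwq hn ν hν
  have hB : ∑' q, I q = I q₁ + ∑' ν, I (qw ν) + ∑' q : ↥Sᶜ, I q := by
    rw [← (ENNReal.summable.tsum_add_tsum_compl (s := S) ENNReal.summable), hS,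
      ENNReal.summable.tsum_union_disjoint hdisj ENNReal.summable, tsum_singleton, tsum_range I (mk_wq_injective wq hwq)]
  -- Step C: the identity cell `I q₁ = ‖f h‖ₑ · ∫⁻ β`
  have hC : I q₁ = ‖f h‖ₑ * ∫⁻ u, β u ∂νN := by
    have h1 : ∀ u : unipDelta L e dV hdV dW hdW, Fq q₁ u = ‖f h‖ₑ := fun u => by
      rw [hFq]
      dsimp only
      rw [hq₁, apply_out_mk_one_mul hf, apply_unipDelta_mul hf u.2 h]
    rw [hI]
    dsimp only
    simp_rw [h1]
    exact lintegral_const_mul _ hβ.1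
  -- Step D: the free `w_Δ`-cell (§2)
  have hD : ∑' ν, I (qw ν) = ∫⁻ u, ‖f (weylDelta L e dV hdV dW hdW * (u : HA L e dV hdV dW hdW) * h)‖ₑ ∂νN := by
    rw [← lintegral_weylDelta_orbit_unfold νN hβ hfc h]
    have h1 : ∀ u : unipDelta L e dV hdV dW hdW,
        (∑' ν : unipDeltaRat L e dV hdV dW hdW, ‖f (weylDelta L e dV hdV dW hdW * ((ν : unipDelta L e dV hdV dW hdW) : HA L e dV hdV dW hdW) *
          ((u : HA L e dV hdV dW hdW) * h))‖ₑ) * β u = ∑' ν : unipDeltaRat L e dV hdV dW hdW, Fq (qw ν) u * β u := by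
      intro u
      rw [← ENNReal.tsum_mul_right]
      refine tsum_congr fun ν => ?_
      rw [hFq]
      dsimp only
      rw [hqw]
      dsimp only
      rw [apply_out_mk_wq_mul wq hwq hf ν]
    simp_rw [h1]
    rw [lintegral_tsum (f := fun ν u => Fq (qw ν) u * β u) fun ν => ((hFqm (qw ν)).mul hβ.1).aemeasurable]
  -- Step E: the remaining cosets, Tonelli backwards
  have hE : ∑' q : ↥Sᶜ, I q = ∫⁻ u, (∑' q : ↥Sᶜ, Fq q u) * β u ∂νN := by
    have h1 : ∀ u, (∑' q : ↥Sᶜ, Fq q u) * β u = ∑' q : ↥Sᶜ, Fq q u * β u := fun u => ENNReal.tsum_mul_right.symm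
    simp_rw [h1]
    rw [lintegral_tsum (f := fun (q : ↥Sᶜ) u => Fq q u * β u) fun q : ↥Sᶜ => ((hFqm q).mul hβ.1).aemeasurable]
  rw [hA, hB, hC, hD, hE]
  rfl

include hwq in
/-- **COROLLARY (under the analytic binder (H) of REPORT-FIRST O41.4): the three cells are finite.**  If the absolute constant term
`∫⁻ (Σ'_q ‖f(γ_q u h)‖ₑ) β dνN` is finite (local integrability of the #9 majorant over one weighted fundamental domain of `N_Δ(L⁺)\N_Δ(𝔸)`;
holds for `Re s > n/2`), then so are `‖f(h)‖ₑ·∫⁻β`, the intertwining integral `∫⁻ ‖f(w_Δ u h)‖ₑ dνN`, and the REST cell.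
[cite: MoeglinWaldspurger1995, II.1.6–II.1.7] [cite: Tan1999, §2] -/
theorem three_cells_ne_top (hn : 0 < n) (νN : Measure (unipDelta L e dV hdV dW hdW)) [νN.IsMulLeftInvariant]
    {β : unipDelta L e dV hdV dW hdW → ℝ≥0∞} (hβ : IsCoveringWeight (unipDeltaRat L e dV hdV dW hdW) β)
    {χ : HeckeCharacter L} {s : ℂ} {f : HA L e dV hdV dW hdW → ℂ} (hf : IsSiegelDeltaSection L e dV hdV dW hdW χ s f) (hfc : Continuous f)
    (h : HA L e dV hdV dW hdW)
    (hH : ∫⁻ u, (∑' q : SiegelDeltaQuot L e dV hdV dW hdW,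
        ‖f ((((Quotient.out q : ratH L e dV hdV dW hdW) : HA L e dV hdV dW hdW)) * ((u : HA L e dV hdV dW hdW) * h))‖ₑ) * β u ∂νN ≠ ∞) :
    ‖f h‖ₑ * ∫⁻ u, β u ∂νN ≠ ∞ ∧
      ∫⁻ u, ‖f (weylDelta L e dV hdV dW hdW * (u : HA L e dV hdV dW hdW) * h)‖ₑ ∂νN ≠ ∞ ∧
      ∫⁻ u, (∑' q : ↥(({Quotient.mk (MulAction.orbitRel (siegelDeltaRat L e dV hdV dW hdW) (ratH L e dV hdV dW hdW)) 1} ∪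
            Set.range (fun ν : unipDeltaRat L e dV hdV dW hdW =>
              (Quotient.mk (MulAction.orbitRel (siegelDeltaRat L e dV hdV dW hdW) (ratH L e dV hdV dW hdW)) (wq ν) :
                SiegelDeltaQuot L e dV hdV dW hdW)))ᶜ : Set (SiegelDeltaQuot L e dV hdV dW hdW)),
          ‖f ((((Quotient.out (q : SiegelDeltaQuot L e dV hdV dW hdW) : ratH L e dV hdV dW hdW) : HA L e dV hdV dW hdW)) *
            ((u : HA L e dV hdV dW hdW) * h))‖ₑ) * β u ∂νN ≠ ∞ := by
  rw [lintegral_constTerm_abs_three_cells wq hwq hn νN hβ hf hfc h] at hH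
  exact ⟨ENNReal.add_ne_top.1 (ENNReal.add_ne_top.1 hH).1 |>.1, ENNReal.add_ne_top.1 (ENNReal.add_ne_top.1 hH).1 |>.2,
    (ENNReal.add_ne_top.1 hH).2⟩

include hwq in
/-- **COROLLARY — O41.3 AT `h` FROM (H): the Siegel intertwining integrand `u ↦ f_s(w_Δ u h)` is `νN`-integrable on `N_Δ(𝔸)`**, so
`M(s)f_s(h) = intertwiningDelta νN f h` (★ D9) is an honest Bochner integral, as soon as the absolute constant term of the majorant series is
finite over one weighted fundamental domain of `N_Δ(L⁺)\N_Δ(𝔸)` (binder (H); for K2Liu-p06's O41.3 this is the step «(H) ⇒ convergence at h»).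
[cite: MoeglinWaldspurger1995, II.1.6] [cite: Tan1999, §2] [cite: GelbartPiatetskishapiroRallis1987, Part A §2] -/
theorem integrable_weylDelta_mul_of_lintegral_ne_top (hn : 0 < n) (νN : Measure (unipDelta L e dV hdV dW hdW)) [νN.IsMulLeftInvariant]
    {β : unipDelta L e dV hdV dW hdW → ℝ≥0∞} (hβ : IsCoveringWeight (unipDeltaRat L e dV hdV dW hdW) β)
    {χ : HeckeCharacter L} {s : ℂ} {f : HA L e dV hdV dW hdW → ℂ} (hf : IsSiegelDeltaSection L e dV hdV dW hdW χ s f) (hfc : Continuous f)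
    (h : HA L e dV hdV dW hdW)
    (hH : ∫⁻ u, (∑' q : SiegelDeltaQuot L e dV hdV dW hdW,
        ‖f ((((Quotient.out q : ratH L e dV hdV dW hdW) : HA L e dV hdV dW hdW)) * ((u : HA L e dV hdV dW hdW) * h))‖ₑ) * β u ∂νN ≠ ∞) :
    Integrable (fun u : unipDelta L e dV hdV dW hdW => f (weylDelta L e dV hdV dW hdW * (u : HA L e dV hdV dW hdW) * h)) νN :=
  ⟨(hfc.comp ((continuous_const.mul continuous_subtype_val).mul continuous_const)).aestronglyMeasurable,
    lt_top_iff_ne_top.2 (three_cells_ne_top wq hwq hn νN hβ hf hfc h hH).2.1⟩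

end Split

end Summit.HodgeConjecture.HodgeConjecture.Cruxes.HLiu418.K2LiuConstantTermBigCellUnfold

end
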